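import Mathlib

/-!
# The weights of the one-factor relay step of (SD) at `(u,0)`, and their coverage identities
(seat mine-b, cell pub-perc-repro2; conjectures/MINE-B.md §45.8)

Pure rational arithmetic in the atoms `a = #R_X`, `c = #C_X` of the peeled flow-one factor and `P = T_Y(u,0)`,
`Q = T_Y(u−1,0)`, `S = T_Y(u−1,1)`, `U = T_Y(u−2,1)` of the other factor: the counts `#E(u,0) = a Q + (a+c) P`
(`relayU0E`), `#E(u−1,1) = a U + a Q + c S` (`relayU0E'`), the seven FORCED weights `relayU0W` (the (SD) shift and
the flip of the whole `R`-part, the flip of its row-tail part, the relax of its `E_Y(u−1,1)` part, the (SD) move and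
the red-axis move of the `B`-part, the (SD) move of the `C`-part), their non-negativity under the three count
inequalities (I) `P (Q + U) ≤ S (P + Q)`, (II) `c Q S ≤ (a + c) P (U + Q)`, (III) `S #E ((a+c) Q + a U) ≤
Q (a S + (a+c) P) #E'` (`relayU0W_nonneg` — these three are exactly the non-negativity of the weights), and the eight
density identities of the source / target coverage (`relayU0_src*`, `relayU0_tgt*`), each a rational identity.
At `u = 2` the weights are a different certificate from `Tail2DRelayWeights` for the same position; (I) is then
`Δ ≥ 0` and (II) follows from `T₁₁ ≤ 2 T₂₀`.
-/

namespace Summit.Ventures.PercRepro2.Tail2D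

section WeightsU0

/-- `#E(u,0)` of `X ∥ Y` in the atoms `a = #R_X`, `c = #C_X`, `P = T_Y(u,0)`, `Q = T_Y(u−1,0)` -/
def relayU0E (a c P Q : ℚ) : ℚ := a * Q + (a + c) * P
/-- `#E(u−1,1)` of `X ∥ Y` in the atoms `a`, `c`, `Q`, `S = T_Y(u−1,1)`, `U = T_Y(u−2,1)` -/
def relayU0E' (a c Q S U : ℚ) : ℚ := a * U + a * Q + c * S

/-- the seven weights of the relay at `(u,0)`: the (SD) shift of the whole `R`-part, its flip, the flip of the
row-tail part, the relax of the `E_Y(u−1,1)` part, the (SD) move and the red-axis move of the `B`-part, and the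
(SD) move of the `C`-part -/
def relayU0W (a c P Q S U : ℚ) : Fin 7 → ℚ :=
  ![a * U / relayU0E' a c Q S U,
    (a * S / relayU0E a c P Q - (a + c) * (S / relayU0E' a c Q S U - P / relayU0E a c P Q)) * Q / S
      - a * U / relayU0E' a c Q S U,
    a * (Q - S) / relayU0E a c P Q
      - (a * S / relayU0E a c P Q - (a + c) * (S / relayU0E' a c Q S U - P / relayU0E a c P Q)) * (Q - S) / S,
    (a + c) * (S / relayU0E' a c Q S U - P / relayU0E a c P Q),
    a * P / relayU0E a c P Q - (a * Q * (1 / relayU0E' a c Q S U - 1 / relayU0E a c P Q) + a * U / relayU0E' a c Q S U),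
    a * Q * (1 / relayU0E' a c Q S U - 1 / relayU0E a c P Q) + a * U / relayU0E' a c Q S U,
    c * P / relayU0E a c P Q]

variable {a c P Q S U : ℚ}

/-- `#E(u,0) > 0` -/
theorem relayU0E_pos (ha : 0 < a) (hc : 0 ≤ c) (hP : 0 < P) (hQ : 0 ≤ Q) : 0 < relayU0E a c P Q := by
  unfold relayU0E; positivity
/-- `#E(u−1,1) > 0` -/
theorem relayU0E'_pos (ha : 0 < a) (hc : 0 ≤ c) (hQ : 0 < Q) (hS : 0 ≤ S) (hU : 0 ≤ U) : 0 < relayU0E' a c Q S U := by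
  unfold relayU0E'; positivity

/-- the weights are non-negative under the three count inequalities (I) `P (Q + U) ≤ S (P + Q)`,
(II) `c Q S ≤ (a + c) P (U + Q)`, (III) `S #E ((a+c) Q + a U) ≤ Q (a S + (a+c) P) #E'` -/
theorem relayU0W_nonneg (ha : 0 < a) (hc : 0 ≤ c) (hP : 0 < P) (hQ : 0 < Q) (hS : 0 < S) (hU : 0 ≤ U) (hSQ : S ≤ Q)
    (hI : P * (Q + U) ≤ S * (P + Q)) (hII : c * Q * S ≤ (a + c) * P * (U + Q))
    (hIII : S * relayU0E a c P Q * ((a + c) * Q + a * U) ≤ Q * (a * S + (a + c) * P) * relayU0E' a c Q S U)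
    (k : Fin 7) : 0 ≤ relayU0W a c P Q S U k := by
  have hE := relayU0E_pos ha hc hP hQ.le
  have hE' := relayU0E'_pos ha hc hQ hS.le hU
  -- (I) in the two forms used: `S #E ≥ P #E'` and `(P + Q) #E' ≥ (Q + U) #E`
  have hI1 : P * relayU0E' a c Q S U ≤ S * relayU0E a c P Q := by
    unfold relayU0E relayU0E'; nlinarith [mul_le_mul_of_nonneg_left hI ha.le]
  have hI2 : (Q + U) * relayU0E a c P Q ≤ (P + Q) * relayU0E' a c Q S U := by
    unfold relayU0E relayU0E'; nlinarith [mul_le_mul_of_nonneg_left hI hc]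
  have hII' : Q * (relayU0E' a c Q S U - relayU0E a c P Q) ≤ U * relayU0E a c P Q := by
    unfold relayU0E relayU0E'; nlinarith
  have w4 : 0 ≤ (a + c) * (S / relayU0E' a c Q S U - P / relayU0E a c P Q) := by
    refine mul_nonneg (by linarith) ?_
    rw [sub_nonneg, div_le_div_iff₀ hE hE']; linarith
  have w6 : 0 ≤ a * Q * (1 / relayU0E' a c Q S U - 1 / relayU0E a c P Q) + a * U / relayU0E' a c Q S U := by
    have : a * Q * (1 / relayU0E' a c Q S U - 1 / relayU0E a c P Q) + a * U / relayU0E' a c Q S U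
        = a * (U * relayU0E a c P Q - Q * (relayU0E' a c Q S U - relayU0E a c P Q))
          / (relayU0E a c P Q * relayU0E' a c Q S U) := by
      field_simp; ring
    rw [this]; apply div_nonneg _ (by positivity)
    exact mul_nonneg ha.le (by linarith)
  have w2 : 0 ≤ (a * S / relayU0E a c P Q - (a + c) * (S / relayU0E' a c Q S U - P / relayU0E a c P Q)) * Q / S
      - a * U / relayU0E' a c Q S U := by
    have : (a * S / relayU0E a c P Q - (a + c) * (S / relayU0E' a c Q S U - P / relayU0E a c P Q)) * Q / S
        - a * U / relayU0E' a c Q S U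
        = (Q * (a * S + (a + c) * P) * relayU0E' a c Q S U - S * relayU0E a c P Q * ((a + c) * Q + a * U))
          / (S * relayU0E a c P Q * relayU0E' a c Q S U) := by
      field_simp; ring
    rw [this]; apply div_nonneg _ (by positivity); linarith
  fin_cases k
  · show 0 ≤ a * U / relayU0E' a c Q S U; positivity
  · exact w2
  · show 0 ≤ a * (Q - S) / relayU0E a c P Q
      - (a * S / relayU0E a c P Q - (a + c) * (S / relayU0E' a c Q S U - P / relayU0E a c P Q)) * (Q - S) / S
    have : a * (Q - S) / relayU0E a c P Q
        - (a * S / relayU0E a c P Q - (a + c) * (S / relayU0E' a c Q S U - P / relayU0E a c P Q)) * (Q - S) / S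
        = (Q - S) * (a + c) * (S * relayU0E a c P Q - P * relayU0E' a c Q S U)
          / (S * relayU0E a c P Q * relayU0E' a c Q S U) := by
      field_simp; ring
    rw [this]; apply div_nonneg _ (by positivity)
    exact mul_nonneg (mul_nonneg (by linarith) (by linarith)) (by linarith)
  · exact w4
  · show 0 ≤ a * P / relayU0E a c P Q
      - (a * Q * (1 / relayU0E' a c Q S U - 1 / relayU0E a c P Q) + a * U / relayU0E' a c Q S U)
    have : a * P / relayU0E a c P Q
        - (a * Q * (1 / relayU0E' a c Q S U - 1 / relayU0E a c P Q) + a * U / relayU0E' a c Q S U)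
        = a * ((P + Q) * relayU0E' a c Q S U - (Q + U) * relayU0E a c P Q)
          / (relayU0E a c P Q * relayU0E' a c Q S U) := by
      field_simp; ring
    rw [this]; apply div_nonneg _ (by positivity); exact mul_nonneg ha.le (by linarith)
  · exact w6
  · show 0 ≤ c * P / relayU0E a c P Q; positivity

/-- source coverage on `E_Y(m+1,1) × R` -/
theorem relayU0_srcA (ha : a ≠ 0) (hQ : Q ≠ 0) (hS : S ≠ 0) (hE : relayU0E a c P Q ≠ 0) (hE' : relayU0E' a c Q S U ≠ 0) :
    relayU0W a c P Q S U 0 * (Q⁻¹ * a⁻¹) + (relayU0W a c P Q S U 1 * (Q⁻¹ * a⁻¹) + relayU0W a c P Q S U 3 * (S⁻¹ * a⁻¹))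
      = (relayU0E a c P Q)⁻¹ := by
  simp only [relayU0W, Matrix.cons_val]
  field_simp
  try unfold relayU0E
  try unfold relayU0E'
  ring

/-- source coverage on `D_Y(m+1,0) × R` -/
theorem relayU0_srcD (ha : a ≠ 0) (hQ : Q ≠ 0) (hS : S ≠ 0) (hQS : Q - S ≠ 0) (hE : relayU0E a c P Q ≠ 0)
    (hE' : relayU0E' a c Q S U ≠ 0) :
    relayU0W a c P Q S U 0 * (Q⁻¹ * a⁻¹)
      + (relayU0W a c P Q S U 1 * (Q⁻¹ * a⁻¹) + relayU0W a c P Q S U 2 * ((Q - S)⁻¹ * a⁻¹))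
      = (relayU0E a c P Q)⁻¹ := by
  simp only [relayU0W, Matrix.cons_val]
  field_simp
  try unfold relayU0E
  try unfold relayU0E'
  ring

/-- source coverage on `E_Y(m+2,0) × B` -/
theorem relayU0_srcB (ha : a ≠ 0) (hP : P ≠ 0) (hE : relayU0E a c P Q ≠ 0) (hE' : relayU0E' a c Q S U ≠ 0) :
    relayU0W a c P Q S U 4 * (P⁻¹ * a⁻¹) + relayU0W a c P Q S U 5 * (P⁻¹ * a⁻¹) = (relayU0E a c P Q)⁻¹ := by
  simp only [relayU0W, Matrix.cons_val]
  field_simp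
  try unfold relayU0E
  try unfold relayU0E'
  ring

/-- source coverage on `E_Y(m+2,0) × C` -/
theorem relayU0_srcC (hc : c ≠ 0) (hP : P ≠ 0) (hE : relayU0E a c P Q ≠ 0) :
    relayU0W a c P Q S U 6 * (P⁻¹ * c⁻¹) = (relayU0E a c P Q)⁻¹ := by
  simp only [relayU0W, Matrix.cons_val]
  field_simp

/-- target coverage on `E_Y(m,1) × R` -/
theorem relayU0_tgtR (ha : a ≠ 0) (hU : U ≠ 0) (hE' : relayU0E' a c Q S U ≠ 0) :
    relayU0W a c P Q S U 0 * (U⁻¹ * a⁻¹) = (relayU0E' a c Q S U)⁻¹ := by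
  simp only [relayU0W, Matrix.cons_val]
  field_simp

/-- target coverage on `E_Y(m+1,1) × B` -/
theorem relayU0_tgtB1 (ha : a ≠ 0) (hca : c + a ≠ 0) (hQ : Q ≠ 0) (hS : S ≠ 0) (hE : relayU0E a c P Q ≠ 0)
    (hE' : relayU0E' a c Q S U ≠ 0) :
    relayU0W a c P Q S U 1 * (Q⁻¹ * a⁻¹)
      + (relayU0W a c P Q S U 3 * (S⁻¹ * (c + a)⁻¹)
        + (relayU0W a c P Q S U 4 * (S⁻¹ * a⁻¹) + relayU0W a c P Q S U 5 * (Q⁻¹ * a⁻¹)))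
      = (relayU0E' a c Q S U)⁻¹ := by
  simp only [relayU0W, Matrix.cons_val]
  field_simp
  try unfold relayU0E
  try unfold relayU0E'
  ring

/-- target coverage on `D_Y(m+1,0) × B` -/
theorem relayU0_tgtB2 (ha : a ≠ 0) (hQ : Q ≠ 0) (hS : S ≠ 0) (hQS : Q - S ≠ 0) (hE : relayU0E a c P Q ≠ 0)
    (hE' : relayU0E' a c Q S U ≠ 0) :
    relayU0W a c P Q S U 1 * (Q⁻¹ * a⁻¹)
      + (relayU0W a c P Q S U 2 * ((Q - S)⁻¹ * a⁻¹) + relayU0W a c P Q S U 5 * (Q⁻¹ * a⁻¹))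
      = (relayU0E' a c Q S U)⁻¹ := by
  simp only [relayU0W, Matrix.cons_val]
  field_simp
  try unfold relayU0E
  try unfold relayU0E'
  ring

/-- target coverage on `E_Y(m+1,1) × C` -/
theorem relayU0_tgtC (hc : c ≠ 0) (hca : c + a ≠ 0) (hS : S ≠ 0) (hE : relayU0E a c P Q ≠ 0)
    (hE' : relayU0E' a c Q S U ≠ 0) :
    relayU0W a c P Q S U 3 * (S⁻¹ * (c + a)⁻¹) + relayU0W a c P Q S U 6 * (S⁻¹ * c⁻¹) = (relayU0E' a c Q S U)⁻¹ := by
  simp only [relayU0W, Matrix.cons_val]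
  field_simp
  try unfold relayU0E
  try unfold relayU0E'
  ring

end WeightsU0

end Summit.Ventures.PercRepro2.Tail2D
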